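import Summits.ResolutionOfSingularities.ResolutionOfSingularities.Theses.WeightedInvariant
import Literature.AlgebraicGeometry.Resolution.NonReducedNoResolution
import Literature.AlgebraicGeometry.Resolution.AbsoluteIntegralClosureNoResolution
import Literature.AlgebraicGeometry.Resolution.QuasiProjectiveResolution
import Literature.AlgebraicGeometry.Resolution.ResolutionProjectiveReduction
import Literature.AlgebraicGeometry.Resolution.RegularLocalRingsNormal

/-!
# `WeightedThesis` — negative lemmas: load-bearing hypotheses and the shape of a minimal
# counterexample

Support (negative) lemmas for crux `stmt-ResolutionOfSingularities-0569`
(`Summit.ResolutionOfSingularities.ResolutionOfSingularities.Theses.WeightedInvariant.WeightedThesis`: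
resolution of every reduced separated scheme of finite type over every PERFECT field of
characteristic `p`, for every prime `p` — the resolution conjecture over perfect fields), filed by
the standing disprover (cdisprove gen 1; work file `Cruxes/WeightedThesis/Disproof.lean`). This
file declares NO definition; every dropped-hypothesis variant is written out inline.

* `weightedThesis_false_without_isReduced_at` / `weightedThesis_false_without_isReduced` — with
  `IsReduced X` dropped the statement is FALSE at every prime: `Spec 𝔽_p[ε] → Spec 𝔽_p` is affine
  and of finite type over the perfect field `𝔽_p`, and `Spec 𝔽_p[ε]` has no resolution
  (`Literature.AlgebraicGeometry.Resolution.not_hasResolution_spec_dualNumber`).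
* `weightedThesis_false_without_locallyOfFiniteType_at` / `…_without_locallyOfFiniteType` — with
  `LocallyOfFiniteType f` dropped it is FALSE at every prime: the absolute integral closure
  `Spec 𝔽_p[X]⁺ → Spec 𝔽_p` is affine and reduced and has no resolution
  (`Literature.AlgebraicGeometry.Resolution.not_hasResolution_spec_absoluteIntegralClosure`).
* `weightedThesis_without_perfectField_iff_summit` — with `[PerfectField k]` dropped it is
  literally the summit statement `ResolutionOfSingularities` (so a proof of the crux not using
  perfectness proves the summit and moots `DescentPerfectToAll`).
* `weightedThesis_without_prime_iff` — with `p.Prime` dropped it is `Hironaka1964.{0} ∧ crux`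
  (no field has characteristic `1` or a composite characteristic; characteristic `0` fields are
  perfect): `p.Prime` is decoration modulo Hironaka's theorem.
* `weightedThesis_iff_minimalCase` — modulo the named fact `CossartPiltant2019` (dimension `≤ 3`,
  every field) the crux is equivalent to its case of INTEGRAL CLOSED subschemes of the `ℙⁿ_k` of
  dimension `> 3` (components: `hasResolution_of_forall_closeds`; Chow's lemma:
  `ChowLemmaIntegral_holds`; projective closure: `exists_projectiveClosure`; transport:
  `Scheme.HasResolution.of_isOpenImmersion`, `Scheme.HasResolution.of_isBirational`): a
  refutation of the crux must exhibit a projective variety of dimension `≥ 4` over a perfect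
  field with no proper birational morphism from a regular scheme — i.e. a counterexample to
  resolution of singularities in positive characteristic, of which none is in print.
* `weightedThesis_strengthening_isRegular_false` — the natural strengthening "every reduced
  separated scheme of finite type over a perfect field of characteristic `p` is REGULAR" (the
  identity as resolution) is false at every prime: the cuspidal cubic `Spec 𝔽_p[T², T³]`
  (`cusp_not_isIntegrallyClosed`: `T = T³/T²` is integral, not in `𝔽_p[T², T³]`; a regular local
  ring is integrally closed, Matsumura 19.4 = `isIntegrallyClosed_of_isRegularLocalRing` in the
  tree, and integral closedness is local, `IsIntegrallyClosed.of_localization_maximal`). So the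
  crux has content at every prime already in dimension one.

## Sources
* The Stacks Project, Tag 01RN (birational), Tag 02IS (regular). Folklore reductions; the
  witnesses are the tree's (`NonReducedNoResolution.lean`, `AbsoluteIntegralClosureNoResolution.lean`).
* V. Cossart, O. Piltant, J. Algebra 529 (2019), Thm. 1.1 (named fact `CossartPiltant2019`).
* H. Matsumura, *Commutative Ring Theory*, CUP 1986, Thm. 19.4 (regular local ⇒ normal).
* U. Görtz, T. Wedhorn, *Algebraic Geometry I*, 2nd ed., Thm. 13.100 (Chow's lemma, proved in
  the tree as `ChowLemmaIntegral_holds`).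
-/

noncomputable section

open CategoryTheory AlgebraicGeometry TopologicalSpace
open Literature.AlgebraicGeometry.Resolution
open Summit.ResolutionOfSingularities.ResolutionOfSingularities.Theses.WeightedInvariant

set_option linter.dupNamespace false

namespace Summit.ResolutionOfSingularities.ResolutionOfSingularities.Theorems.WeightedThesis.Negative

/-! ## `IsReduced X` is load-bearing -/

/-- **At every prime, the crux with `IsReduced X` dropped fails**: witness
`Spec 𝔽_p[ε] → Spec 𝔽_p` (affine, of finite type, `𝔽_p` perfect; `Spec 𝔽_p[ε]` has no
resolution). [folklore] -/
theorem weightedThesis_false_without_isReduced_at (p : ℕ) [Fact p.Prime] :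
    ¬ ∀ (k : Type) [Field k] [CharP k p] [PerfectField k] (X : Scheme.{0})
        (f : X ⟶ Spec (.of k)), IsSeparated f → LocallyOfFiniteType f → QuasiCompact f →
          Scheme.HasResolution X := by
  intro h
  haveI : Module.Finite (ZMod p) (DualNumber (ZMod p)) :=
    inferInstanceAs (Module.Finite (ZMod p) (ZMod p × ZMod p))
  let f : Spec (.of (DualNumber (ZMod p))) ⟶ Spec (.of (ZMod p)) :=
    Spec.map (CommRingCat.ofHom (algebraMap (ZMod p) (DualNumber (ZMod p))))
  haveI : LocallyOfFiniteType f :=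
    (HasRingHomProperty.Spec_iff (P := @LocallyOfFiniteType)).mpr
      (RingHom.finiteType_algebraMap.mpr inferInstance)
  exact not_hasResolution_spec_dualNumber (ZMod p)
    (h (ZMod p) (Spec (.of (DualNumber (ZMod p)))) f inferInstance inferInstance inferInstance)

/-- **Any proof of `WeightedThesis` must use `IsReduced X`**: the crux with that hypothesis
dropped is false (already at `p = 2`). [folklore] -/
theorem weightedThesis_false_without_isReduced :
    ¬ ∀ p : ℕ, p.Prime → ∀ (k : Type) [Field k] [CharP k p] [PerfectField k] (X : Scheme.{0})
        (f : X ⟶ Spec (.of k)), IsSeparated f → LocallyOfFiniteType f → QuasiCompact f →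
          Scheme.HasResolution X := fun h =>
  haveI : Fact (Nat.Prime 2) := ⟨Nat.prime_two⟩
  weightedThesis_false_without_isReduced_at 2 (h 2 Nat.prime_two)

/-! ## `LocallyOfFiniteType f` is load-bearing -/

/-- **At every prime, the crux with `LocallyOfFiniteType f` dropped fails**: witness
`Spec 𝔽_p[X]⁺ → Spec 𝔽_p`, the absolute integral closure of the affine line (affine, reduced,
`𝔽_p` perfect; no resolution, every non-generic stalk being non-Noetherian). [folklore] -/
theorem weightedThesis_false_without_locallyOfFiniteType_at (p : ℕ) [Fact p.Prime] :
    ¬ ∀ (k : Type) [Field k] [CharP k p] [PerfectField k] (X : Scheme.{0})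
        (f : X ⟶ Spec (.of k)), IsSeparated f → QuasiCompact f → IsReduced X →
          Scheme.HasResolution X := by
  intro h
  let f : Spec (.of ↥(integralClosure (Polynomial (ZMod p))
      (AlgebraicClosure (RatFunc (ZMod p))))) ⟶ Spec (.of (ZMod p)) :=
    Spec.map (CommRingCat.ofHom ((algebraMap (Polynomial (ZMod p))
      ↥(integralClosure (Polynomial (ZMod p)) (AlgebraicClosure (RatFunc (ZMod p))))).comp
        Polynomial.C))
  exact not_hasResolution_spec_absoluteIntegralClosure p
    (h (ZMod p) _ f inferInstance inferInstance inferInstance)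

/-- **Any proof of `WeightedThesis` must use `LocallyOfFiniteType f`**: the crux with that
hypothesis dropped is false (already at `p = 2`). [folklore] -/
theorem weightedThesis_false_without_locallyOfFiniteType :
    ¬ ∀ p : ℕ, p.Prime → ∀ (k : Type) [Field k] [CharP k p] [PerfectField k] (X : Scheme.{0})
        (f : X ⟶ Spec (.of k)), IsSeparated f → QuasiCompact f → IsReduced X →
          Scheme.HasResolution X := fun h =>
  haveI : Fact (Nat.Prime 2) := ⟨Nat.prime_two⟩
  weightedThesis_false_without_locallyOfFiniteType_at 2 (h 2 Nat.prime_two)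

/-! ## `[PerfectField k]` carries the whole distance to the summit; `p.Prime` is decoration -/

/-- **The crux with `[PerfectField k]` dropped is literally the summit statement.** [folklore] -/
theorem weightedThesis_without_perfectField_iff_summit :
    (∀ p : ℕ, p.Prime → ∀ (k : Type) [Field k] [CharP k p] (X : Scheme.{0})
        (f : X ⟶ Spec (.of k)), IsSeparated f → LocallyOfFiniteType f → QuasiCompact f →
          IsReduced X → Scheme.HasResolution X) ↔ _root_.ResolutionOfSingularities :=
  Iff.rfl

/-- **The crux with `p.Prime` dropped is `Hironaka1964.{0} ∧ WeightedThesis`**: at `p = 0` every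
field is perfect (Hironaka's theorem, the named fact `Hironaka1964`), and no field has
characteristic `1` or a composite characteristic. [folklore] -/
theorem weightedThesis_without_prime_iff :
    (∀ (p : ℕ) (k : Type) [Field k] [CharP k p] [PerfectField k] (X : Scheme.{0})
        (f : X ⟶ Spec (.of k)), IsSeparated f → LocallyOfFiniteType f → QuasiCompact f →
          IsReduced X → Scheme.HasResolution X) ↔ Hironaka1964.{0} ∧ WeightedThesis := by
  constructor
  · intro h
    refine ⟨?_, fun p _ => h p⟩
    intro k _ _ X f a b c d
    haveI : CharZero k := CharP.charP_to_charZero k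
    exact h 0 k X f a b c d
  · rintro ⟨h0, h⟩ p k _ _ _ X f a b c d
    rcases CharP.char_is_prime_or_zero k p with hp | rfl
    · exact h p hp k X f a b c d
    · exact h0 k X f a b c d

/-! ## Shape of a minimal counterexample -/

/-- **Modulo `CossartPiltant2019`, the crux is equivalent to its PROJECTIVE INTEGRAL case in
dimension `> 3`**: a refutation must exhibit an integral closed subscheme of some `ℙⁿ_k`, of
dimension at least four, over a perfect field `k` of prime characteristic, that admits no proper
birational morphism from a regular scheme. (→: a closed subscheme of `ℙⁿ_k` is a reduced
separated `k`-scheme of finite type. ←: reduce to integral components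
(`hasResolution_of_forall_closeds`), dominate by an integral scheme immersed in `ℙⁿ_k` via Chow's
lemma (`ChowLemmaIntegral_holds`), pass to its projective closure (`exists_projectiveClosure`, same
dimension), settle dimension `≤ 3` by `CossartPiltant2019`, and come back along the open immersion
(`Scheme.HasResolution.of_isOpenImmersion`) and the proper birational Chow morphism
(`Scheme.HasResolution.of_isBirational`).) [folklore] -/
theorem weightedThesis_iff_minimalCase (hCP : CossartPiltant2019.{0}) :
    WeightedThesis ↔ ∀ p : ℕ, p.Prime → ∀ (k : Type) [Field k] [CharP k p] [PerfectField k]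
      (n : ℕ) (X : Scheme.{0}) (ι : X ⟶ (Literature.AlgebraicGeometry.Motives.projectiveSpace n k).left),
        IsClosedImmersion ι → IsIntegral X → ¬ topologicalKrullDim X ≤ 3 →
          Scheme.HasResolution X := by
  -- an integral closed subscheme of `ℙⁿ_k` is a reduced separated `k`-scheme of finite type
  have key : ∀ (k : Type) [Field k] (n : ℕ) (X : Scheme.{0})
      (ι : X ⟶ (Literature.AlgebraicGeometry.Motives.projectiveSpace n k).left),
      IsClosedImmersion ι → IsIntegral X →
        IsSeparated (ι ≫ (Literature.AlgebraicGeometry.Motives.projectiveSpace n k).hom) ∧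
        LocallyOfFiniteType (ι ≫ (Literature.AlgebraicGeometry.Motives.projectiveSpace n k).hom) ∧
        QuasiCompact (ι ≫ (Literature.AlgebraicGeometry.Motives.projectiveSpace n k).hom) ∧
        IsReduced X := by
    intro k _ n X ι hι hint
    haveI := hι
    haveI := hint
    haveI : IsProper (Literature.AlgebraicGeometry.Motives.projectiveSpace n k).hom :=
      Literature.AlgebraicGeometry.Motives.isProper_projectiveSpace n k
    exact ⟨inferInstance, inferInstance, inferInstance, inferInstance⟩
  constructor
  · intro h p hp k _ _ _ n X ι hι hint _
    obtain ⟨h1, h2, h3, h4⟩ := key k n X ι hι hint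
    exact h p hp k X _ h1 h2 h3 h4
  · intro h p hp k _ _ _ X f hsep hft hqc hred
    refine hasResolution_of_forall_closeds X f fun Z hZ => ?_
    obtain ⟨n, X', π, ι, hint', hι, hπ, -, -, U, hU, hU', hiso⟩ :=
      ChowLemmaIntegral_holds k _ ((Scheme.IdealSheafData.vanishingIdeal Z).subschemeι ≫ f)
        inferInstance inferInstance inferInstance hZ
    haveI := hπ
    haveI := hι
    haveI := hint'
    refine Scheme.HasResolution.of_isBirational π ⟨U, hU, hU', hiso⟩ ?_
    obtain ⟨Xbar, j, c, hXbar, hj, hc, -, hdimbar⟩ := exists_projectiveClosure ι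
    haveI := hj
    refine Scheme.HasResolution.of_isOpenImmersion j ?_
    by_cases hdim : topologicalKrullDim Xbar ≤ 3
    · obtain ⟨h1, h2, h3, h4⟩ := key k n Xbar c hc hXbar
      exact hCP k Xbar _ h1 h2 h3 h4 hdim
    · exact h p hp k n Xbar c hc hXbar hdim

/-! ## The identity is not a resolution: a reduced singular curve over every `𝔽_p` -/

section Cusp

open Polynomial

variable (K : Type) [Field K]

/-- Elements of the cusp algebra `K[T², T³] = Algebra.adjoin K {T², T³} ⊆ K[T]` have no linear
term. [folklore] -/
theorem cusp_coeff_one_eq_zero {s : K[X]}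
    (hs : s ∈ Algebra.adjoin K ({X ^ 2, X ^ 3} : Set K[X])) : s.coeff 1 = 0 := by
  refine Algebra.adjoin_induction (p := fun s _ => s.coeff 1 = 0) ?_ ?_ ?_ ?_ hs
  · intro x hx
    simp only [Set.mem_insert_iff, Set.mem_singleton_iff] at hx
    rcases hx with hx | hx <;> rw [hx, Polynomial.coeff_X_pow] <;> simp
  · intro r
    show (algebraMap K K[X] r).coeff 1 = 0
    rw [Polynomial.algebraMap_apply, Polynomial.coeff_C]
    simp
  · intro x y _ _ hx hy
    simp [hx, hy]
  · intro x y _ _ hx hy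
    simp [Polynomial.coeff_mul, Finset.Nat.sum_antidiagonal_succ, hx, hy]

/-- `T ∉ K[T², T³]`. [folklore] -/
theorem cusp_X_not_mem : (X : K[X]) ∉ Algebra.adjoin K ({X ^ 2, X ^ 3} : Set K[X]) := fun h => by
  simpa using cusp_coeff_one_eq_zero K h

/-- `K[T², T³]` is not integrally closed: `T = T³/T²` is integral over it (`T² ∈ K[T², T³]`)
but not in it. [folklore] -/
theorem cusp_not_isIntegrallyClosed :
    ¬ IsIntegrallyClosed ↥(Algebra.adjoin K ({X ^ 2, X ^ 3} : Set K[X])) := by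
  intro h
  set A : Subalgebra K K[X] := Algebra.adjoin K ({X ^ 2, X ^ 3} : Set K[X]) with hA
  have h2 : (X ^ 2 : K[X]) ∈ A := Algebra.subset_adjoin (by simp)
  have h3 : (X ^ 3 : K[X]) ∈ A := Algebra.subset_adjoin (by simp)
  let a2 : A := ⟨X ^ 2, h2⟩
  let a3 : A := ⟨X ^ 3, h3⟩
  have ha2 : a2 ≠ 0 := by
    intro h0
    have := congrArg Subtype.val h0
    simp [a2] at this
  let L := FractionRing A
  have ha2L : algebraMap A L a2 ≠ 0 := fun h0 =>
    ha2 ((IsFractionRing.injective A L) (h0.trans (map_zero _).symm))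
  let x : L := algebraMap A L a3 / algebraMap A L a2
  have hx2 : x ^ 2 = algebraMap A L a2 := by
    rw [div_pow, div_eq_iff (pow_ne_zero 2 ha2L), ← map_pow, ← map_pow, ← map_mul]
    congr 1
    apply Subtype.ext
    simp [a2, a3]
    ring
  obtain ⟨y, hy⟩ := IsIntegrallyClosed.exists_algebraMap_eq_of_isIntegral_pow (R := A) (K := L)
    two_pos (hx2 ▸ isIntegral_algebraMap)
  have hy' : algebraMap A L (y * a2) = algebraMap A L a3 := by
    rw [map_mul, hy, div_mul_cancel₀ _ ha2L]
  have hy'' : y * a2 = a3 := IsFractionRing.injective A L hy'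
  have hval : (y : K[X]) * X ^ 2 = X ^ 3 := by
    have := congrArg Subtype.val hy''
    simpa [a2, a3] using this
  have hyX : (y : K[X]) = X := by
    have hX2 : (X ^ 2 : K[X]) ≠ 0 := pow_ne_zero 2 X_ne_zero
    apply mul_right_cancel₀ hX2
    rw [hval]; ring
  have hXA : (X : K[X]) ∈ A := by rw [← hyX]; exact y.2
  exact cusp_X_not_mem K hXA

/-- Some maximal ideal of `K[T², T³]` has a NON-regular local ring (else every localisation at a
maximal ideal would be integrally closed — Matsumura 19.4, `isIntegrallyClosed_of_isRegularLocalRing`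
— hence so would `K[T², T³]`, `IsIntegrallyClosed.of_localization_maximal`). [folklore] -/
theorem cusp_exists_not_isRegularLocalRing :
    ∃ (m : Ideal ↥(Algebra.adjoin K ({X ^ 2, X ^ 3} : Set K[X]))) (_ : m.IsMaximal),
      ¬ IsRegularLocalRing (Localization.AtPrime m) := by
  by_contra hall
  simp only [not_exists, not_not] at hall
  refine cusp_not_isIntegrallyClosed K
    (IsIntegrallyClosed.of_localization_maximal fun m _ hm => ?_)
  haveI := hall m hm
  exact isIntegrallyClosed_of_isRegularLocalRing _

/-- **The cuspidal cubic `Spec K[T², T³]` is not a regular scheme.** [folklore] -/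
theorem not_isRegular_spec_cusp :
    ¬ Scheme.IsRegular (Spec (.of ↥(Algebra.adjoin K ({X ^ 2, X ^ 3} : Set K[X])))) := by
  intro h
  obtain ⟨m, hm, hreg⟩ := cusp_exists_not_isRegularLocalRing K
  let x : PrimeSpectrum ↥(Algebra.adjoin K ({X ^ 2, X ^ 3} : Set K[X])) := ⟨m, hm.isPrime⟩
  haveI := h x
  exact hreg (IsRegularLocalRing.of_ringEquiv
    (Spec.stalkIso (.of ↥(Algebra.adjoin K ({X ^ 2, X ^ 3} : Set K[X]))) x).commRingCatIsoToRingEquiv)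

/-- **Strengthening of `WeightedThesis` refuted, at every prime: not every reduced separated scheme of finite type
over a perfect field of characteristic `p` is regular** — the conclusion `HasResolution X` of the
crux is not witnessed by the identity in general. Witness: the cuspidal cubic
`Spec 𝔽_p[T², T³] → Spec 𝔽_p` (affine, of finite type, reduced as a subring of `𝔽_p[T]`).
[folklore] -/
theorem weightedThesis_strengthening_isRegular_false (p : ℕ) [Fact p.Prime] :
    ¬ ∀ (k : Type) [Field k] [CharP k p] [PerfectField k] (Y : Scheme.{0})
        (f : Y ⟶ Spec (.of k)), IsSeparated f → LocallyOfFiniteType f → QuasiCompact f →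
          IsReduced Y → Scheme.IsRegular Y := by
  intro h
  let A : Subalgebra (ZMod p) (ZMod p)[X] :=
    Algebra.adjoin (ZMod p) ({X ^ 2, X ^ 3} : Set (ZMod p)[X])
  haveI : Algebra.FiniteType (ZMod p) ↥A := by
    refine ⟨(Subalgebra.fg_top A).mpr ⟨{X ^ 2, X ^ 3}, ?_⟩⟩
    simp [A]
  let f : Spec (.of ↥A) ⟶ Spec (.of (ZMod p)) :=
    Spec.map (CommRingCat.ofHom (algebraMap (ZMod p) ↥A))
  haveI : LocallyOfFiniteType f :=
    (HasRingHomProperty.Spec_iff (P := @LocallyOfFiniteType)).mpr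
      (RingHom.finiteType_algebraMap.mpr inferInstance)
  exact not_isRegular_spec_cusp (ZMod p)
    (h (ZMod p) (Spec (.of ↥A)) f inferInstance inferInstance inferInstance inferInstance)

end Cusp

end Summit.ResolutionOfSingularities.ResolutionOfSingularities.Theorems.WeightedThesis.Negative

end
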